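import Summits.PneNP.PneNP.Theorems.PeaTwoMemBPP.Negative.CensusMultiplicative
import Summits.PneNP.PneNP.Theorems.PeaTwoMemBPP.Negative.RenyiAndSignedDegreeReduction

/-!
# PneNP / SzkEntropy — crux `PeaTwoMemBPP` (stmt-PneNP-10778), negative side: census AND directional derivative profiles together do not determine the entropy

Route `PneNP/SzkEntropy`, crux stmt-PneNP-10778 (`PEA 2 ∈ PromiseBPP'`: additive-gap-1 Shannon
entropy approximation for QUADRATIC maps `q : F₂ⁿ → F₂ᵐ` in promise-BPP).  Author: the crux's standing
disprover (refuter-cdisprove, cycle 2).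

The two printed tools for entropy of low-degree maps are (i) the CENSUS of biases of the pencil
`{λ·q}` (Parseval: it is the Rényi-2 entropy; DGRV Claim 5.6) — shown insufficient for Shannon entropy in
`CensusDoesNotDetermineEntropy.lean` / `CensusMultiplicative.lean` — and (ii) DIRECTIONAL DERIVATIVES
`D_h q(x) = q(x+h) − q(x)`, which for quadratic `q` are affine in `x` with linear part the polarization
`B_q(·,h)`; their ranks `ρ(h)` drive DGRV's odd-characteristic algorithm (Lemma 5.1: `ρ(h) ≤ 2H`;
Lemma 5.2: `E_h q^{-ρ(h)} = 2^{-H_Rényi}`) and every "kernel attack" / shrunk-subspace heuristic.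
This file records ALL first-order directional data as two profiles indexed by the `2ⁿ` directions:

* `dirCollision q h = #{x : q(x+h) = q(x)}` (`∈ {0, 2^{n−ρ(h)}}` for quadratic `q`; its mean over `h`
  is the collision count `collisionCount q`, `sum_dirCollision`), and
* `dirKernel q h = #{x : B_q(x,h) = 0} = 2^{n − ρ(h)}` (the derivative-rank profile, rank-free form),

proves that both are MULTIPLICATIVE under direct products (`dirCollision_prod`, `dirKernel_prod`, exactly
as the census, `census_prod`), and exhibits quadratic maps `witE`, `witF : F₂⁴ → F₂⁴` with

  identical census, identical collision profile and identical kernel profile (all `2⁴` directions,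
  pointwise), but `H(witE) = 5/2` and `H(witF) = 7/2 − (3/8)log₂ 3 = 2.9056…` (`entropy_gap_EF`: gap `> 2/5`).

Consequently (`profile_equivalent_gap_unbounded`): for every `T` there are quadratic maps agreeing in
census, collision profile and kernel profile whose Shannon entropies differ by more than `T` bits.
**No procedure reading only the bias census of the pencil together with the ranks / collision
probabilities of all `2ⁿ` directional derivatives approximates the entropy of quadratic maps over `F₂`
to within any additive constant** — the Shannon entropy depends on genuinely two-point, positional data
(which `x` collide in which direction), not on any per-character or per-direction statistic.
A three-variable instance of the collision-profile phenomenon alone: `(z, zx, zy)` versus `(z, xy)`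
(`dirCollision_witZ₁_eq_witZ₂`, entropies `2` and `1 + h(1/4)`).

References: Z. Dvir, D. Gutfreund, G. N. Rothblum, S. Vadhan, *On approximating the entropy of
polynomial mappings*, ICS 2011 (ECCC TR10-160), Lemma 5.1, Lemma 5.2, Claim 5.6, §3 p. 6;
R. Lidl, H. Niederreiter, *Finite Fields*, Ch. 6 (quadratic forms in characteristic 2).
-/

namespace Summit.PneNP.PneNP.Theorems.PeaTwoMemBPP.Negative

open Literature.Computability.Complexity Literature.InformationTheory.Entropy
open PolyMapF2

variable {n n' : ℕ}

/-! ### The two directional profiles -/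

/-- **Directional collision count** `W_P(h) = #{x ∈ F₂ⁿ : P(x + h) = P(x)}`; `W_P(h)/2ⁿ` is the
probability that `P` collides along `h`.  For quadratic `P`, `x ↦ P(x+h) − P(x)` is affine, so
`W_P(h) ∈ {0, 2^{n − ρ(h)}}`. [DvirGutfreundRothblumVadhan2010, Lemma 5.2] -/
def dirCollision (P : PolyMapF2 n) (h : Fin n → ZMod 2) : ℕ :=
  ∑ x : Fin n → ZMod 2, if P.eval (x + h) = P.eval x then 1 else 0

/-- Coordinatewise sum of two output lists (over `F₂`, sum = difference). [folklore] -/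
def addL (l₁ l₂ : List (ZMod 2)) : List (ZMod 2) := List.zipWith (· + ·) l₁ l₂

/-- **Directional kernel count** `K_P(h) = #{x : B_P(x,h) = 0}` for the polarization
`B_P(x,h) = P(x+h) + P(x) + P(h) + P(0)` (written as `P(x+h) + P(x) = P(h) + P(0)`).  For quadratic `P`,
`B_P(·,h)` is linear and `K_P(h) = 2^{n − ρ(h)}` with `ρ(h) = rank B_P(·,h)` the directional-derivative
rank of DGRV's algorithm — so `K_P` IS the rank profile, in rank-free form. [DvirGutfreundRothblumVadhan2010, Lemma 5.1–5.2] -/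
def dirKernel (P : PolyMapF2 n) (h : Fin n → ZMod 2) : ℕ :=
  ∑ x : Fin n → ZMod 2, if addL (P.eval (x + h)) (P.eval x) = addL (P.eval h) (P.eval 0) then 1 else 0

/-- The collision profile sums to the collision count `#{(x,x') : P x = P x'}` (`= 4ⁿ·2^{-H₂}`): the
profile refines the Rényi-2 entropy. [DvirGutfreundRothblumVadhan2010, Claim 5.6] -/
theorem sum_dirCollision (P : PolyMapF2 n) : ∑ h, dirCollision P h = collisionCount P := by
  unfold dirCollision collisionCount
  rw [Finset.sum_comm]
  refine Finset.sum_congr rfl fun x _ => ?_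
  have e := Equiv.sum_comp (Equiv.addLeft x) (fun h' => if P.eval h' = P.eval x then (1 : ℕ) else 0)
  simp only [Equiv.coe_addLeft] at e
  refine e.trans ?_
  rw [fiber, Finset.card_filter]

/-! ### Multiplicativity under direct products -/

/-- Appends with matching first lengths are equal iff both parts are. [folklore] -/
theorem append_eq_append_iff_of_length {α : Type*} {a b c d : List α} (h : a.length = c.length) :
    a ++ b = c ++ d ↔ a = c ∧ b = d :=
  ⟨fun e => List.append_inj e h, fun ⟨e₁, e₂⟩ => by rw [e₁, e₂]⟩

/-- `addL` distributes over appends with matching lengths. [folklore] -/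
theorem addL_append {a₁ a₂ b₁ b₂ : List (ZMod 2)} (h : a₁.length = b₁.length) :
    addL (a₁ ++ a₂) (b₁ ++ b₂) = addL a₁ b₁ ++ addL a₂ b₂ := by
  unfold addL
  rw [List.zipWith_append h]

/-- Length of a coordinatewise sum. [folklore] -/
@[simp] theorem length_addL (a b : List (ZMod 2)) : (addL a b).length = min a.length b.length := by
  unfold addL; rw [List.length_zipWith]

/-- Product of indicators is the indicator of the conjunction (in `ℕ`). [folklore] -/
theorem ite_one_zero_mul {p q : Prop} [Decidable p] [Decidable q] :
    ((if p then 1 else 0) * (if q then 1 else 0) : ℕ) = if p ∧ q then 1 else 0 := by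
  by_cases hp : p <;> by_cases hq : q <;> simp [hp, hq]

/-- The first block of `Fin.append x₁ x₂ + h` is `x₁ + h₁`. [folklore] -/
theorem append_add_castAdd (x₁ : Fin n → ZMod 2) (x₂ : Fin n' → ZMod 2) (h : Fin (n + n') → ZMod 2) :
    (fun i => (Fin.append x₁ x₂ + h) (Fin.castAdd n' i)) = x₁ + fun i => h (Fin.castAdd n' i) := by
  funext i; simp [Fin.append_left]

/-- The second block of `Fin.append x₁ x₂ + h` is `x₂ + h₂`. [folklore] -/
theorem append_add_natAdd (x₁ : Fin n → ZMod 2) (x₂ : Fin n' → ZMod 2) (h : Fin (n + n') → ZMod 2) :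
    (fun j => (Fin.append x₁ x₂ + h) (Fin.natAdd n j)) = x₂ + fun j => h (Fin.natAdd n j) := by
  funext j; simp [Fin.append_right]

/-- The first block of `Fin.append x₁ x₂` is `x₁`. [folklore] -/
theorem append_castAdd (x₁ : Fin n → ZMod 2) (x₂ : Fin n' → ZMod 2) :
    (fun i => (Fin.append x₁ x₂) (Fin.castAdd n' i)) = x₁ := by
  funext i; simp [Fin.append_left]

/-- The second block of `Fin.append x₁ x₂` is `x₂`. [folklore] -/
theorem append_natAdd (x₁ : Fin n → ZMod 2) (x₂ : Fin n' → ZMod 2) :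
    (fun j => (Fin.append x₁ x₂) (Fin.natAdd n j)) = x₂ := by
  funext j; simp [Fin.append_right]

/-- Restricting the zero vector of `F₂^{n+n'}` to the first block gives `0`. [folklore] -/
theorem zero_castAdd : (fun i => (0 : Fin (n + n') → ZMod 2) (Fin.castAdd n' i)) = 0 := rfl
/-- Restricting the zero vector of `F₂^{n+n'}` to the second block gives `0`. [folklore] -/
theorem zero_natAdd : (fun j => (0 : Fin (n + n') → ZMod 2) (Fin.natAdd n j)) = 0 := rfl

/-- Pointwise factorisation of the collision indicator on a direct product. [folklore] -/
theorem dirCollision_term_append (P : PolyMapF2 n) (Q : PolyMapF2 n') (h : Fin (n + n') → ZMod 2)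
    (x₁ : Fin n → ZMod 2) (x₂ : Fin n' → ZMod 2) :
    (if (P.prod Q).eval (Fin.append x₁ x₂ + h) = (P.prod Q).eval (Fin.append x₁ x₂) then 1 else 0 : ℕ) =
      (if P.eval (x₁ + fun i => h (Fin.castAdd n' i)) = P.eval x₁ then 1 else 0) *
      (if Q.eval (x₂ + fun j => h (Fin.natAdd n j)) = Q.eval x₂ then 1 else 0) := by
  rw [ite_one_zero_mul, eval_prod, eval_prod, append_add_castAdd, append_add_natAdd, append_castAdd,
    append_natAdd]
  exact if_congr (append_eq_append_iff_of_length (by rw [length_eval, length_eval])) rfl rfl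

/-- **The collision profile of a direct product is the product of the profiles**:
`W_{P×Q}(h₁,h₂) = W_P(h₁)·W_Q(h₂)`. [DvirGutfreundRothblumVadhan2010, §3 p. 6 (direct products)] -/
theorem dirCollision_prod (P : PolyMapF2 n) (Q : PolyMapF2 n') (h : Fin (n + n') → ZMod 2) :
    dirCollision (P.prod Q) h =
      dirCollision P (fun i => h (Fin.castAdd n' i)) * dirCollision Q (fun j => h (Fin.natAdd n j)) := by
  unfold dirCollision
  rw [Finset.sum_mul_sum, ← Finset.sum_product', Finset.univ_product_univ,
    ← Equiv.sum_comp (Fin.appendEquiv n n')]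
  exact Finset.sum_congr rfl fun x _ => dirCollision_term_append P Q h x.1 x.2

/-- Pointwise factorisation of the kernel indicator on a direct product. [folklore] -/
theorem dirKernel_term_append (P : PolyMapF2 n) (Q : PolyMapF2 n') (h : Fin (n + n') → ZMod 2)
    (x₁ : Fin n → ZMod 2) (x₂ : Fin n' → ZMod 2) :
    (if addL ((P.prod Q).eval (Fin.append x₁ x₂ + h)) ((P.prod Q).eval (Fin.append x₁ x₂)) =
        addL ((P.prod Q).eval h) ((P.prod Q).eval 0) then 1 else 0 : ℕ) =
      (if addL (P.eval (x₁ + fun i => h (Fin.castAdd n' i))) (P.eval x₁) =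
          addL (P.eval fun i => h (Fin.castAdd n' i)) (P.eval 0) then 1 else 0) *
      (if addL (Q.eval (x₂ + fun j => h (Fin.natAdd n j))) (Q.eval x₂) =
          addL (Q.eval fun j => h (Fin.natAdd n j)) (Q.eval 0) then 1 else 0) := by
  rw [ite_one_zero_mul, eval_prod, eval_prod, eval_prod, eval_prod, append_add_castAdd,
    append_add_natAdd, append_castAdd, append_natAdd, zero_castAdd, zero_natAdd,
    addL_append (by rw [length_eval, length_eval]), addL_append (by rw [length_eval, length_eval])]
  exact if_congr (append_eq_append_iff_of_length
    (by rw [length_addL, length_addL, length_eval, length_eval, length_eval, length_eval])) rfl rfl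

/-- **The kernel (derivative-rank) profile of a direct product is the product of the profiles**:
`K_{P×Q}(h₁,h₂) = K_P(h₁)·K_Q(h₂)` (ranks of block-diagonal derivatives add).
[DvirGutfreundRothblumVadhan2010, §3 p. 6; Lemma 5.2] -/
theorem dirKernel_prod (P : PolyMapF2 n) (Q : PolyMapF2 n') (h : Fin (n + n') → ZMod 2) :
    dirKernel (P.prod Q) h =
      dirKernel P (fun i => h (Fin.castAdd n' i)) * dirKernel Q (fun j => h (Fin.natAdd n j)) := by
  unfold dirKernel
  rw [Finset.sum_mul_sum, ← Finset.sum_product', Finset.univ_product_univ,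
    ← Equiv.sum_comp (Fin.appendEquiv n n')]
  exact Finset.sum_congr rfl fun x _ => dirKernel_term_append P Q h x.1 x.2

/-- Collision-profile equivalence is preserved by direct products. [folklore] -/
theorem dirCollision_prod_congr {P P' : PolyMapF2 n} {Q Q' : PolyMapF2 n'}
    (hP : dirCollision P = dirCollision P') (hQ : dirCollision Q = dirCollision Q') :
    dirCollision (P.prod Q) = dirCollision (P'.prod Q') := by
  funext h
  rw [dirCollision_prod, dirCollision_prod, hP, hQ]

/-- Kernel-profile equivalence is preserved by direct products. [folklore] -/
theorem dirKernel_prod_congr {P P' : PolyMapF2 n} {Q Q' : PolyMapF2 n'}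
    (hP : dirKernel P = dirKernel P') (hQ : dirKernel Q = dirKernel Q') :
    dirKernel (P.prod Q) = dirKernel (P'.prod Q') := by
  funext h
  rw [dirKernel_prod, dirKernel_prod, hP, hQ]

/-- … and by direct powers. [folklore] -/
theorem dirCollision_pow_congr {P P' : PolyMapF2 n} (h : dirCollision P = dirCollision P') :
    ∀ t : ℕ, dirCollision (pow P t) = dirCollision (pow P' t)
  | 0 => rfl
  | t + 1 => dirCollision_prod_congr (dirCollision_pow_congr h t) h

/-- … and by direct powers. [folklore] -/
theorem dirKernel_pow_congr {P P' : PolyMapF2 n} (h : dirKernel P = dirKernel P') :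
    ∀ t : ℕ, dirKernel (pow P t) = dirKernel (pow P' t)
  | 0 => rfl
  | t + 1 => dirKernel_prod_congr (dirKernel_pow_congr h t) h

/-! ### The witness pair on `n = 4`, `m = 4` (random search `c/trisearch.c`, this session) -/

/-- `E = (1 + x₀ + x₁ + x₀x₂ + x₁x₃, x₀x₃ + x₂x₃, x₀ + x₁ + x₀x₂ + x₁x₃ + x₂x₃, 1 + x₃ + x₂x₃)`:
fibre profile `4,4,2,2,2,2`, `Π = 2^24`, `H = 5/2`. -/
def witE : PolyMapF2 4 :=
  [[[], [0], [1], [0, 2], [1, 3]], [[0, 3], [2, 3]], [[0], [1], [0, 2], [1, 3], [2, 3]], [[], [3], [2, 3]]]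

/-- `F = (x₃ + x₂x₃, 1 + x₀x₃, 1 + x₂ + x₃ + x₀x₂ + x₁x₃ + x₂x₃, x₂x₃)`:
fibre profile `6,2,1×8`, `Π = 2^8·3^6`, `H = 7/2 − (3/8)log₂ 3 = 2.9056…`. -/
def witF : PolyMapF2 4 :=
  [[[3], [2, 3]], [[], [0, 3]], [[], [2], [3], [0, 2], [1, 3], [2, 3]], [[2, 3]]]

/-- `E` is quadratic. [folklore] -/
theorem witE_degLE : witE.DegLE 2 := by decide
/-- `F` is quadratic. [folklore] -/
theorem witF_degLE : witF.DegLE 2 := by decide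
/-- Same signed bias census (16 characters, by evaluation). [folklore] -/
theorem census_witE_eq_witF : census witE = census witF := by native_decide
/-- Same directional collision profile (16 directions, pointwise, by evaluation). [folklore] -/
theorem dirCollision_witE_eq_witF : dirCollision witE = dirCollision witF := by native_decide
/-- Same directional kernel (= derivative-rank) profile (16 directions, pointwise). [folklore] -/
theorem dirKernel_witE_eq_witF : dirKernel witE = dirKernel witF := by native_decide
/-- `Π(E) = 2^24`. [folklore] -/
theorem fiberProd_witE : fiberProd witE = 2 ^ 24 := by native_decide
/-- `Π(F) = 2^8·3^6`. [folklore] -/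
theorem fiberProd_witF : fiberProd witF = 2 ^ 8 * 3 ^ 6 := by native_decide
/-- `H(E(U₄)) = 5/2` exactly. [folklore] -/
theorem entropy_witE : witE.entropy = 5 / 2 := by
  rw [entropy_of_fiberProd_eq_two_pow fiberProd_witE]; norm_num

/-- **Base gap**: `2/5 < H(F) − H(E)` (true value `1 − (3/8)log₂3 = 0.40563…`), for two quadratic maps
with identical census, collision profile and kernel profile. -/
theorem entropy_gap_EF : (2 : ℝ) / 5 < witF.entropy - witE.entropy := by
  have h : 2 ^ 32 * fiberProd witF ^ 5 < fiberProd witE ^ 5 := by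
    rw [fiberProd_witE, fiberProd_witF]; norm_num
  have := entropy_gap_of_fiberProd_pow (by norm_num) h
  norm_num at this ⊢
  linarith

/-- **Census, collision profile and kernel profile together do not determine the Shannon entropy of
quadratic maps** (gap `> 2/5` at `n = m = 4`). -/
theorem profiles_do_not_determine_entropy :
    ∃ n : ℕ, ∃ C D : PolyMapF2 n, C.DegLE 2 ∧ D.DegLE 2 ∧ census C = census D ∧
      dirCollision C = dirCollision D ∧ dirKernel C = dirKernel D ∧
      (2 : ℝ) / 5 < D.entropy - C.entropy :=
  ⟨4, witE, witF, witE_degLE, witF_degLE, census_witE_eq_witF, dirCollision_witE_eq_witF,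
    dirKernel_witE_eq_witF, entropy_gap_EF⟩

/-- **Unbounded gaps**: for every `T`, quadratic maps (direct powers of `witE`, `witF` on `4(3T+3)`
variables) agreeing in census, collision profile and kernel profile, with `H(D) − H(C) > T`.  Hence no
function of (bias census, directional collision probabilities, directional derivative ranks)
approximates the Shannon entropy of quadratic maps over `F₂` to within ANY additive constant.
[DvirGutfreundRothblumVadhan2010, §3 p. 6 (products), Lemma 5.1–5.2, Claim 5.6 (the three statistics)] -/
theorem profile_equivalent_gap_unbounded (T : ℕ) :
    ∃ N : ℕ, ∃ C D : PolyMapF2 N, C.DegLE 2 ∧ D.DegLE 2 ∧ census C = census D ∧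
      dirCollision C = dirCollision D ∧ dirKernel C = dirKernel D ∧
      (T : ℝ) < D.entropy - C.entropy := by
  obtain ⟨hc, hgap⟩ := census_gap_amplify census_witE_eq_witF entropy_gap_EF (3 * T + 3)
  refine ⟨4 * (3 * T + 3), pow witE (3 * T + 3), pow witF (3 * T + 3), pow_degLE witE_degLE _,
    pow_degLE witF_degLE _, hc, dirCollision_pow_congr dirCollision_witE_eq_witF _,
    dirKernel_pow_congr dirKernel_witE_eq_witF _, lt_of_lt_of_le ?_ hgap⟩
  push_cast
  nlinarith

/-! ### The three-variable collision-profile example -/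

/-- `Z₁ = (z, zx, zy)` on `F₂³` (`x,y,z = x₀,x₁,x₂`): reveals `(x,y)` iff `z = 1`; `H = 2`. -/
def witZ₁ : PolyMapF2 3 := [[[2]], [[0, 2]], [[1, 2]]]
/-- `Z₂ = (z, xy)`: `H = 1 + h(1/4) = 1.8113`. -/
def witZ₂ : PolyMapF2 3 := [[[2]], [[0, 1]]]

/-- `(z, zx, zy)` and `(z, xy)` have the same directional collision profile (`8; 4,4,4; 0,…,0`)
although their kernel profiles and entropies (`2` vs `1 + h(1/4)`) differ: the collision profile does
not even see the ranks of the non-colliding directions. [folklore] -/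
theorem dirCollision_witZ₁_eq_witZ₂ : dirCollision witZ₁ = dirCollision witZ₂ := by native_decide
/-- … while the kernel profiles differ. [folklore] -/
theorem dirKernel_witZ₁_ne_witZ₂ : dirKernel witZ₁ ≠ dirKernel witZ₂ := by native_decide
/-- `Π(Z₁) = 2^8` (`H = 3 − 8/8 = 2`). [folklore] -/
theorem fiberProd_witZ₁ : fiberProd witZ₁ = 2 ^ 8 := by native_decide
/-- `Π(Z₂) = 3^6` (`H = 3 − (6/8)log₂3`). [folklore] -/
theorem fiberProd_witZ₂ : fiberProd witZ₂ = 3 ^ 6 := by native_decide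

end Summit.PneNP.PneNP.Theorems.PeaTwoMemBPP.Negative
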